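import Summits.Langlands.Langlands.Theses.SchurParitySplit
import Literature.NumberTheory.Automorphic.ACCAutomorphyLiftingCrystalline
import Literature.NumberTheory.Automorphic.Qian2022PotentialAutomorphy
import Literature.NumberTheory.Automorphic.EssConjSelfDual
import Literature.NumberTheory.GaloisRepresentations.ExtendedAdequateSubgroup
import Literature.NumberTheory.GaloisRepresentations.AbsGaloisOuterConj
/-!
BC3 BIRTH SKELETON — residual O `OddSchurLayerLifting` of the child route `SchurParitySplit` (lens-5 g15; refines SCH stmt-Langlands-27235), with the
typed ENGINE item T⁺ `NearlyAdequateOrdinaryMinimalLifting` (support) IN-CONE as the named stub `stub_Tplus`.  POST-BIRTH form: imports the born route file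
`Theses/SchurParitySplit.lean`; O and T⁺ are the route decls BY NAME (`OddSchurLayerLifting_holds` concludes the route decl).  Three registered stubs: the engine T⁺ (a sentence in print at p = 2,
referee-grade at odd p), the FRAME REDUCTION «T⁺ ⇒ O over CM K» (the transport lemma: where all the transverse darkness lives), and REST (K not CM);
kernel-checked composition `OddSchurLayerLifting_of` (one case split on CM-ness; modus ponens on T⁺).  None ⟺ O or SCH (kit probes P7).
sorries ONLY inside `stub_*`.
-/
set_option linter.dupNamespace false
namespace Summit.Langlands.Langlands.Cruxes.OddSchurLayerLifting.Birth
open Filter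

open Summit.Langlands.Langlands.Theses.SchurParitySplit (OddSchurLayerLifting NearlyAdequateOrdinaryMinimalLifting)

/-- ENGINE stub = the route's support item T⁺ `NearlyAdequateOrdinaryMinimalLifting` (Thorne 2017 Thm 5.1, minimal crystalline-ordinary case,
¬(p = 2 ∧ n even), with Def 2.20 adequacy of ρ̄(Γ_{F(ζ_p)}) weakened to NEAR adequacy: Hom(H,k) = 0 ∧ H¹(H, ad) = 0 ∧ semisimple span; over canonical
local Artin data).  p = 2: IN PRINT — Boxer–Calegari–Gee–Pilloni arXiv:2502.20645 Def 294 / Rem 295 («the arguments of [Thorne 2017] apply unchanged»),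
Lemma 298 + Prop 299 (Taylor–Wiles primes under near adequacy) [pp. 84, 87–89] — vendorable as a Literature named fact and then this stub closes at
p = 2 by citation; p ODD (the primes O needs): NOT in print — referee-grade remark (Prop 2.21 reads the image only via Hom(H,𝔽_p) = 0, the
eigen-condition and inflation–restriction with coefficients in the FULL ad; Lemmas 2.17–2.19 use absolute irreducibility only; the argument is
prime-uniform) — to be PROVED by re-running Thorne §§2–4 with near adequacy, or refuted by exhibiting a second use of H¹(H, ad/Z) = 0.  Size: L
(a careful referee pass; formalisation-heavy). -/
theorem stub_Tplus : NearlyAdequateOrdinaryMinimalLifting := by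
  sorry

/-- FRAME REDUCTION «engine ⇒ CM sector»: granted T⁺, O holds over imaginary CM fields K.  Content (the transport, = g11 TRANS / g13–g14 CM-stub pattern
with the dial now LINEAR adequacy): pass to the solvable layer M ⊇ K(ζ_ℓ) of the hull over which the linearly adequate layer J IS the residual image
(Galois correspondence; M/K solvable, M chosen CM inside a CM closure or replaced by Thorne's F = M·E), residual automorphy over M by solvable base change
(Arthur–Clozel) of LiftTail's linked ρ′, polarisation ρ^c ≅ ρ^∨ε^{1−n} from CycIrr + essential self-duality where available, the MINIMAL
crystalline-ORDINARY frame of T⁺ (same local behaviour as ρ′ everywhere; ordinary of a common labelled weight at v ∣ ℓ), `Qian2022.IsAutomorphic` ↦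
LiftTail's conclusion, and descent M → K by the lineage's CSD.  DARK (booked, not evaded): non-polarisable ρ (`TwistedEndoscopySelfDual`), non-minimal or
non-ordinary local conditions (`PatchingLocalComponentBarrier`: at odd ℓ ∣ n Ihara avoidance à la Taylor is unavailable — Thorne p. 2 «a theorem of
minimal type»), general Hodge types (weight cycling needs ℓ > n).  Genuine lemma (it is where O's instances meet the engine's frame); size L/open. -/
theorem stub_o_cm_of_Tplus : NearlyAdequateOrdinaryMinimalLifting →   ∀ (K : Type) [Field K] [NumberField K] (n : ℕ) (hcpt : Literature.NumberTheory.Automorphic.isCompact_glFiniteIntegralLevel n K), 0 < n → Summit.Langlands.Langlands.Theorems.CoreAdequacy.LiftBelow n → ∀ (ℓ : ℕ) [Fact ℓ.Prime] (ι : PadicAlgCl ℓ ≃+* ℂ) (ρ : Literature.NumberTheory.GaloisRepresentations.FramedGaloisRep K (PadicAlgCl ℓ) n), ℓ < 2 * (n + 1) → ℓ ≠ 2 → NumberField.IsCMField K → Summit.Langlands.Langlands.Theorems.CoreAdequacy.CycIrr ρ → ¬ Summit.Langlands.Langlands.Theorems.CoreAdequacy.AdequateCyclotomicImage ρ → ¬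 Summit.Langlands.Langlands.Theorems.CoreAdequacy.SolvablyAdequateImage ρ → ¬ Summit.Langlands.Langlands.Theorems.CoreAdequacy.LieDefect.SolvableDescentShadow ρ → ¬ Summit.Langlands.Langlands.Theorems.CoreAdequacy.LieDefect.SolvablyQuasiAdequateImage ρ → ℓ ≤ n → ¬ (∃ τ : Field.absoluteGaloisGroup (CyclotomicField ℓ K) →* Matrix.GeneralLinearGroup (Fin n) (Literature.NumberTheory.GaloisRepresentations.padicAlgClResidueField ℓ), (ρ.restrictField (CyclotomicField ℓ K)).IsReductionOf (RingHom.id (Literature.NumberTheory.GaloisRepresentations.padicAlgClResidueField ℓ)) τ ∧ Literature.NumberTheory.GaloisRepresentations.IsAbsIrreducible τ ∧ ∃ J : Subgroup (Matrix.GeneralLinearGroup (Fin n) (Literature.NumberTheory.GaloisRepresentations.padicAlgClResidueField ℓ)), Summit.Langlands.Langlands.Theorems.CoreAdequacy.LieDefect.AboveCore τ.range J ∧ J ≤ τ.range ∧ Literature.NumberTheory.GaloisRepresentations.IsAbsIrreducible J.subtype ∧ Literature.NumberTheory.GaloisRepresentations.Subgroup.IsExtendedAdequate J) → (∃ τ :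 Field.absoluteGaloisGroup (CyclotomicField ℓ K) →* Matrix.GeneralLinearGroup (Fin n) (Literature.NumberTheory.GaloisRepresentations.padicAlgClResidueField ℓ), (ρ.restrictField (CyclotomicField ℓ K)).IsReductionOf (RingHom.id (Literature.NumberTheory.GaloisRepresentations.padicAlgClResidueField ℓ)) τ ∧ Literature.NumberTheory.GaloisRepresentations.IsAbsIrreducible τ ∧ Literature.NumberTheory.GaloisRepresentations.IsAbsIrreducible (Summit.Langlands.Langlands.Theorems.CoreAdequacy.perfectCore τ.range).subtype) → ¬ (∃ (E : Type) (_ : Field E) (_ : NumberField E) (_ : Algebra K E), IsGalois K E ∧ IsSolvable (E ≃ₐ[K] E) ∧ ((∃ (σ : Literature.NumberTheory.GaloisRepresentations.FramedGaloisRep E (PadicAlgCl ℓ) 2) (χ : Literature.NumberTheory.GaloisRepresentations.FramedGaloisRep E (PadicAlgCl ℓ) 1), σ.toGaloisRep.IsIrreducible ∧ Summit.Langlands.Langlands.Theorems.CoreAdequacy.LieDefect.Geometric σ ∧ Summit.Langlands.Langlands.Theorems.CoreAdequacy.LieDefect.Geometric χ ∧ ∀ g : Field.absoluteGaloisGroup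 E, 2 * Literature.NumberTheory.GaloisRepresentations.FramedRep.trace (ρ.restrictField E) g = Literature.NumberTheory.GaloisRepresentations.FramedRep.trace χ g * (Literature.NumberTheory.GaloisRepresentations.FramedRep.trace σ g ^ 2 + Literature.NumberTheory.GaloisRepresentations.FramedRep.trace σ (g * g))) ∨ (∃ σ₁ σ₂ : Literature.NumberTheory.GaloisRepresentations.FramedGaloisRep E (PadicAlgCl ℓ) 2, σ₁.toGaloisRep.IsIrreducible ∧ σ₂.toGaloisRep.IsIrreducible ∧ Summit.Langlands.Langlands.Theorems.CoreAdequacy.LieDefect.Geometric σ₁ ∧ Summit.Langlands.Langlands.Theorems.CoreAdequacy.LieDefect.Geometric σ₂ ∧ ∀ g : Field.absoluteGaloisGroup E, Literature.NumberTheory.GaloisRepresentations.FramedRep.trace (ρ.restrictField E) g = Literature.NumberTheory.GaloisRepresentations.FramedRep.trace σ₁ g * Literature.NumberTheory.GaloisRepresentations.FramedRep.trace σ₂ g))) → (∃ τ : Field.absoluteGaloisGroup (CyclotomicField ℓ K) →* Matrix.GeneralLinearGroup (Fin n) (Literature.NumberTheory.GaloisRepresentations.padicAlgClResidueField ℓ),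 (ρ.restrictField (CyclotomicField ℓ K)).IsReductionOf (RingHom.id (Literature.NumberTheory.GaloisRepresentations.padicAlgClResidueField ℓ)) τ ∧ Literature.NumberTheory.GaloisRepresentations.IsAbsIrreducible τ ∧ ∃ J : Subgroup (Matrix.GeneralLinearGroup (Fin n) (Literature.NumberTheory.GaloisRepresentations.padicAlgClResidueField ℓ)), Summit.Langlands.Langlands.Theorems.CoreAdequacy.LieDefect.AboveCore τ.range J ∧ J ≤ τ.range ∧ Literature.NumberTheory.GaloisRepresentations.IsAbsIrreducible J.subtype ∧ (∀ f : Additive J →+ Literature.NumberTheory.GaloisRepresentations.padicAlgClResidueField ℓ, f = 0) ∧ groupCohomology.cocycles₁ (Rep.of (Literature.NumberTheory.GaloisRepresentations.Subgroup.adRep J)) ≤ groupCohomology.coboundaries₁ (Rep.of (Literature.NumberTheory.GaloisRepresentations.Subgroup.adRep J)) ∧ Literature.NumberTheory.GaloisRepresentations.Subgroup.semisimpleSpan J = ⊤) → ¬ Summit.Langlands.Langlands.Theorems.BrightMate.SolvablyReducible ρ → ¬ Summit.Langlands.Langlands.Theorems.BrightMate.SolvablyMated ι ρ → Summit.Langlands.Langlands.Theorems.CoreAdequacy.LiftTail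 K n hcpt ℓ ι ρ := by
  sorry

/-- REST: K not CM (totally real K: quadratic CM base change K·E/K for the polarised part + descent — plan; K neither: no patching,
`TaylorWilesNumericalCoincidence`).  Size: open. -/
theorem stub_o_rest :   ∀ (K : Type) [Field K] [NumberField K] (n : ℕ) (hcpt : Literature.NumberTheory.Automorphic.isCompact_glFiniteIntegralLevel n K), 0 < n → Summit.Langlands.Langlands.Theorems.CoreAdequacy.LiftBelow n → ∀ (ℓ : ℕ) [Fact ℓ.Prime] (ι : PadicAlgCl ℓ ≃+* ℂ) (ρ : Literature.NumberTheory.GaloisRepresentations.FramedGaloisRep K (PadicAlgCl ℓ) n), ℓ < 2 * (n + 1) → ℓ ≠ 2 → ¬ NumberField.IsCMField K → Summit.Langlands.Langlands.Theorems.CoreAdequacy.CycIrr ρ → ¬ Summit.Langlands.Langlands.Theorems.CoreAdequacy.AdequateCyclotomicImage ρ → ¬ Summit.Langlands.Langlands.Theorems.CoreAdequacy.SolvablyAdequateImage ρ → ¬ Summit.Langlands.Langlands.Theorems.CoreAdequacy.LieDefect.SolvableDescentShadow ρ → ¬ Summit.Langlands.Langlands.Theorems.CoreAdequacy.LieDefect.SolvablyQuasiAdequateImage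 ρ → ℓ ≤ n → ¬ (∃ τ : Field.absoluteGaloisGroup (CyclotomicField ℓ K) →* Matrix.GeneralLinearGroup (Fin n) (Literature.NumberTheory.GaloisRepresentations.padicAlgClResidueField ℓ), (ρ.restrictField (CyclotomicField ℓ K)).IsReductionOf (RingHom.id (Literature.NumberTheory.GaloisRepresentations.padicAlgClResidueField ℓ)) τ ∧ Literature.NumberTheory.GaloisRepresentations.IsAbsIrreducible τ ∧ ∃ J : Subgroup (Matrix.GeneralLinearGroup (Fin n) (Literature.NumberTheory.GaloisRepresentations.padicAlgClResidueField ℓ)), Summit.Langlands.Langlands.Theorems.CoreAdequacy.LieDefect.AboveCore τ.range J ∧ J ≤ τ.range ∧ Literature.NumberTheory.GaloisRepresentations.IsAbsIrreducible J.subtype ∧ Literature.NumberTheory.GaloisRepresentations.Subgroup.IsExtendedAdequate J) → (∃ τ : Field.absoluteGaloisGroup (CyclotomicField ℓ K) →* Matrix.GeneralLinearGroup (Fin n) (Literature.NumberTheory.GaloisRepresentations.padicAlgClResidueField ℓ), (ρ.restrictField (CyclotomicField ℓ K)).IsReductionOf (RingHom.id (Literature.NumberTheory.GaloisRepresentations.padicAlgClResidueField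 ℓ)) τ ∧ Literature.NumberTheory.GaloisRepresentations.IsAbsIrreducible τ ∧ Literature.NumberTheory.GaloisRepresentations.IsAbsIrreducible (Summit.Langlands.Langlands.Theorems.CoreAdequacy.perfectCore τ.range).subtype) → ¬ (∃ (E : Type) (_ : Field E) (_ : NumberField E) (_ : Algebra K E), IsGalois K E ∧ IsSolvable (E ≃ₐ[K] E) ∧ ((∃ (σ : Literature.NumberTheory.GaloisRepresentations.FramedGaloisRep E (PadicAlgCl ℓ) 2) (χ : Literature.NumberTheory.GaloisRepresentations.FramedGaloisRep E (PadicAlgCl ℓ) 1), σ.toGaloisRep.IsIrreducible ∧ Summit.Langlands.Langlands.Theorems.CoreAdequacy.LieDefect.Geometric σ ∧ Summit.Langlands.Langlands.Theorems.CoreAdequacy.LieDefect.Geometric χ ∧ ∀ g : Field.absoluteGaloisGroup E, 2 * Literature.NumberTheory.GaloisRepresentations.FramedRep.trace (ρ.restrictField E) g = Literature.NumberTheory.GaloisRepresentations.FramedRep.trace χ g * (Literature.NumberTheory.GaloisRepresentations.FramedRep.trace σ g ^ 2 + Literature.NumberTheory.GaloisRepresentations.FramedRep.trace σ (g * g)))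 ∨ (∃ σ₁ σ₂ : Literature.NumberTheory.GaloisRepresentations.FramedGaloisRep E (PadicAlgCl ℓ) 2, σ₁.toGaloisRep.IsIrreducible ∧ σ₂.toGaloisRep.IsIrreducible ∧ Summit.Langlands.Langlands.Theorems.CoreAdequacy.LieDefect.Geometric σ₁ ∧ Summit.Langlands.Langlands.Theorems.CoreAdequacy.LieDefect.Geometric σ₂ ∧ ∀ g : Field.absoluteGaloisGroup E, Literature.NumberTheory.GaloisRepresentations.FramedRep.trace (ρ.restrictField E) g = Literature.NumberTheory.GaloisRepresentations.FramedRep.trace σ₁ g * Literature.NumberTheory.GaloisRepresentations.FramedRep.trace σ₂ g))) → (∃ τ : Field.absoluteGaloisGroup (CyclotomicField ℓ K) →* Matrix.GeneralLinearGroup (Fin n) (Literature.NumberTheory.GaloisRepresentations.padicAlgClResidueField ℓ), (ρ.restrictField (CyclotomicField ℓ K)).IsReductionOf (RingHom.id (Literature.NumberTheory.GaloisRepresentations.padicAlgClResidueField ℓ)) τ ∧ Literature.NumberTheory.GaloisRepresentations.IsAbsIrreducible τ ∧ ∃ J : Subgroup (Matrix.GeneralLinearGroup (Fin n) (Literature.NumberTheory.GaloisRepresentations.padicAlgClResidueField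 ℓ)), Summit.Langlands.Langlands.Theorems.CoreAdequacy.LieDefect.AboveCore τ.range J ∧ J ≤ τ.range ∧ Literature.NumberTheory.GaloisRepresentations.IsAbsIrreducible J.subtype ∧ (∀ f : Additive J →+ Literature.NumberTheory.GaloisRepresentations.padicAlgClResidueField ℓ, f = 0) ∧ groupCohomology.cocycles₁ (Rep.of (Literature.NumberTheory.GaloisRepresentations.Subgroup.adRep J)) ≤ groupCohomology.coboundaries₁ (Rep.of (Literature.NumberTheory.GaloisRepresentations.Subgroup.adRep J)) ∧ Literature.NumberTheory.GaloisRepresentations.Subgroup.semisimpleSpan J = ⊤) → ¬ Summit.Langlands.Langlands.Theorems.BrightMate.SolvablyReducible ρ → ¬ Summit.Langlands.Langlands.Theorems.BrightMate.SolvablyMated ι ρ → Summit.Langlands.Langlands.Theorems.CoreAdequacy.LiftTail K n hcpt ℓ ι ρ := by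
  sorry

/-- The split ENGINE → (ENGINE ⇒ CM) → REST → O (modus ponens and one case split on `NumberField.IsCMField K`; no other content). -/
theorem OddSchurLayerLifting_of :
    NearlyAdequateOrdinaryMinimalLifting →
    (NearlyAdequateOrdinaryMinimalLifting →   ∀ (K : Type) [Field K] [NumberField K] (n : ℕ) (hcpt : Literature.NumberTheory.Automorphic.isCompact_glFiniteIntegralLevel n K), 0 < n → Summit.Langlands.Langlands.Theorems.CoreAdequacy.LiftBelow n → ∀ (ℓ : ℕ) [Fact ℓ.Prime] (ι : PadicAlgCl ℓ ≃+* ℂ) (ρ : Literature.NumberTheory.GaloisRepresentations.FramedGaloisRep K (PadicAlgCl ℓ) n), ℓ < 2 * (n + 1) → ℓ ≠ 2 → NumberField.IsCMField K → Summit.Langlands.Langlands.Theorems.CoreAdequacy.CycIrr ρ → ¬ Summit.Langlands.Langlands.Theorems.CoreAdequacy.AdequateCyclotomicImage ρ → ¬ Summit.Langlands.Langlands.Theorems.CoreAdequacy.SolvablyAdequateImage ρ → ¬ Summit.Langlands.Langlands.Theorems.CoreAdequacy.LieDefect.SolvableDescentShadow ρ → ¬ Summit.Langlands.Langlands.Theorems.CoreAdequacy.LieDefect.SolvablyQuasiAdequateImage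 ρ → ℓ ≤ n → ¬ (∃ τ : Field.absoluteGaloisGroup (CyclotomicField ℓ K) →* Matrix.GeneralLinearGroup (Fin n) (Literature.NumberTheory.GaloisRepresentations.padicAlgClResidueField ℓ), (ρ.restrictField (CyclotomicField ℓ K)).IsReductionOf (RingHom.id (Literature.NumberTheory.GaloisRepresentations.padicAlgClResidueField ℓ)) τ ∧ Literature.NumberTheory.GaloisRepresentations.IsAbsIrreducible τ ∧ ∃ J : Subgroup (Matrix.GeneralLinearGroup (Fin n) (Literature.NumberTheory.GaloisRepresentations.padicAlgClResidueField ℓ)), Summit.Langlands.Langlands.Theorems.CoreAdequacy.LieDefect.AboveCore τ.range J ∧ J ≤ τ.range ∧ Literature.NumberTheory.GaloisRepresentations.IsAbsIrreducible J.subtype ∧ Literature.NumberTheory.GaloisRepresentations.Subgroup.IsExtendedAdequate J) → (∃ τ : Field.absoluteGaloisGroup (CyclotomicField ℓ K) →* Matrix.GeneralLinearGroup (Fin n) (Literature.NumberTheory.GaloisRepresentations.padicAlgClResidueField ℓ), (ρ.restrictField (CyclotomicField ℓ K)).IsReductionOf (RingHom.id (Literature.NumberTheory.GaloisRepresentations.padicAlgClResidueField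 ℓ)) τ ∧ Literature.NumberTheory.GaloisRepresentations.IsAbsIrreducible τ ∧ Literature.NumberTheory.GaloisRepresentations.IsAbsIrreducible (Summit.Langlands.Langlands.Theorems.CoreAdequacy.perfectCore τ.range).subtype) → ¬ (∃ (E : Type) (_ : Field E) (_ : NumberField E) (_ : Algebra K E), IsGalois K E ∧ IsSolvable (E ≃ₐ[K] E) ∧ ((∃ (σ : Literature.NumberTheory.GaloisRepresentations.FramedGaloisRep E (PadicAlgCl ℓ) 2) (χ : Literature.NumberTheory.GaloisRepresentations.FramedGaloisRep E (PadicAlgCl ℓ) 1), σ.toGaloisRep.IsIrreducible ∧ Summit.Langlands.Langlands.Theorems.CoreAdequacy.LieDefect.Geometric σ ∧ Summit.Langlands.Langlands.Theorems.CoreAdequacy.LieDefect.Geometric χ ∧ ∀ g : Field.absoluteGaloisGroup E, 2 * Literature.NumberTheory.GaloisRepresentations.FramedRep.trace (ρ.restrictField E) g = Literature.NumberTheory.GaloisRepresentations.FramedRep.trace χ g * (Literature.NumberTheory.GaloisRepresentations.FramedRep.trace σ g ^ 2 + Literature.NumberTheory.GaloisRepresentations.FramedRep.trace σ (g * g)))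 ∨ (∃ σ₁ σ₂ : Literature.NumberTheory.GaloisRepresentations.FramedGaloisRep E (PadicAlgCl ℓ) 2, σ₁.toGaloisRep.IsIrreducible ∧ σ₂.toGaloisRep.IsIrreducible ∧ Summit.Langlands.Langlands.Theorems.CoreAdequacy.LieDefect.Geometric σ₁ ∧ Summit.Langlands.Langlands.Theorems.CoreAdequacy.LieDefect.Geometric σ₂ ∧ ∀ g : Field.absoluteGaloisGroup E, Literature.NumberTheory.GaloisRepresentations.FramedRep.trace (ρ.restrictField E) g = Literature.NumberTheory.GaloisRepresentations.FramedRep.trace σ₁ g * Literature.NumberTheory.GaloisRepresentations.FramedRep.trace σ₂ g))) → (∃ τ : Field.absoluteGaloisGroup (CyclotomicField ℓ K) →* Matrix.GeneralLinearGroup (Fin n) (Literature.NumberTheory.GaloisRepresentations.padicAlgClResidueField ℓ), (ρ.restrictField (CyclotomicField ℓ K)).IsReductionOf (RingHom.id (Literature.NumberTheory.GaloisRepresentations.padicAlgClResidueField ℓ)) τ ∧ Literature.NumberTheory.GaloisRepresentations.IsAbsIrreducible τ ∧ ∃ J : Subgroup (Matrix.GeneralLinearGroup (Fin n) (Literature.NumberTheory.GaloisRepresentations.padicAlgClResidueField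 ℓ)), Summit.Langlands.Langlands.Theorems.CoreAdequacy.LieDefect.AboveCore τ.range J ∧ J ≤ τ.range ∧ Literature.NumberTheory.GaloisRepresentations.IsAbsIrreducible J.subtype ∧ (∀ f : Additive J →+ Literature.NumberTheory.GaloisRepresentations.padicAlgClResidueField ℓ, f = 0) ∧ groupCohomology.cocycles₁ (Rep.of (Literature.NumberTheory.GaloisRepresentations.Subgroup.adRep J)) ≤ groupCohomology.coboundaries₁ (Rep.of (Literature.NumberTheory.GaloisRepresentations.Subgroup.adRep J)) ∧ Literature.NumberTheory.GaloisRepresentations.Subgroup.semisimpleSpan J = ⊤) → ¬ Summit.Langlands.Langlands.Theorems.BrightMate.SolvablyReducible ρ → ¬ Summit.Langlands.Langlands.Theorems.BrightMate.SolvablyMated ι ρ → Summit.Langlands.Langlands.Theorems.CoreAdequacy.LiftTail K n hcpt ℓ ι ρ) →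
    (  ∀ (K : Type) [Field K] [NumberField K] (n : ℕ) (hcpt : Literature.NumberTheory.Automorphic.isCompact_glFiniteIntegralLevel n K), 0 < n → Summit.Langlands.Langlands.Theorems.CoreAdequacy.LiftBelow n → ∀ (ℓ : ℕ) [Fact ℓ.Prime] (ι : PadicAlgCl ℓ ≃+* ℂ) (ρ : Literature.NumberTheory.GaloisRepresentations.FramedGaloisRep K (PadicAlgCl ℓ) n), ℓ < 2 * (n + 1) → ℓ ≠ 2 → ¬ NumberField.IsCMField K → Summit.Langlands.Langlands.Theorems.CoreAdequacy.CycIrr ρ → ¬ Summit.Langlands.Langlands.Theorems.CoreAdequacy.AdequateCyclotomicImage ρ → ¬ Summit.Langlands.Langlands.Theorems.CoreAdequacy.SolvablyAdequateImage ρ → ¬ Summit.Langlands.Langlands.Theorems.CoreAdequacy.LieDefect.SolvableDescentShadow ρ → ¬ Summit.Langlands.Langlands.Theorems.CoreAdequacy.LieDefect.SolvablyQuasiAdequateImage ρ → ℓ ≤ n → ¬ (∃ τ : Field.absoluteGaloisGroup (CyclotomicField ℓ K) →* Matrix.GeneralLinearGroup (Fin n) (Literature.NumberTheory.GaloisRepresentations.padicAlgClResidueField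 ℓ), (ρ.restrictField (CyclotomicField ℓ K)).IsReductionOf (RingHom.id (Literature.NumberTheory.GaloisRepresentations.padicAlgClResidueField ℓ)) τ ∧ Literature.NumberTheory.GaloisRepresentations.IsAbsIrreducible τ ∧ ∃ J : Subgroup (Matrix.GeneralLinearGroup (Fin n) (Literature.NumberTheory.GaloisRepresentations.padicAlgClResidueField ℓ)), Summit.Langlands.Langlands.Theorems.CoreAdequacy.LieDefect.AboveCore τ.range J ∧ J ≤ τ.range ∧ Literature.NumberTheory.GaloisRepresentations.IsAbsIrreducible J.subtype ∧ Literature.NumberTheory.GaloisRepresentations.Subgroup.IsExtendedAdequate J) → (∃ τ : Field.absoluteGaloisGroup (CyclotomicField ℓ K) →* Matrix.GeneralLinearGroup (Fin n) (Literature.NumberTheory.GaloisRepresentations.padicAlgClResidueField ℓ), (ρ.restrictField (CyclotomicField ℓ K)).IsReductionOf (RingHom.id (Literature.NumberTheory.GaloisRepresentations.padicAlgClResidueField ℓ)) τ ∧ Literature.NumberTheory.GaloisRepresentations.IsAbsIrreducible τ ∧ Literature.NumberTheory.GaloisRepresentations.IsAbsIrreducible (Summit.Langlands.Langlands.Theorems.CoreAdequacy.perfectCore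 τ.range).subtype) → ¬ (∃ (E : Type) (_ : Field E) (_ : NumberField E) (_ : Algebra K E), IsGalois K E ∧ IsSolvable (E ≃ₐ[K] E) ∧ ((∃ (σ : Literature.NumberTheory.GaloisRepresentations.FramedGaloisRep E (PadicAlgCl ℓ) 2) (χ : Literature.NumberTheory.GaloisRepresentations.FramedGaloisRep E (PadicAlgCl ℓ) 1), σ.toGaloisRep.IsIrreducible ∧ Summit.Langlands.Langlands.Theorems.CoreAdequacy.LieDefect.Geometric σ ∧ Summit.Langlands.Langlands.Theorems.CoreAdequacy.LieDefect.Geometric χ ∧ ∀ g : Field.absoluteGaloisGroup E, 2 * Literature.NumberTheory.GaloisRepresentations.FramedRep.trace (ρ.restrictField E) g = Literature.NumberTheory.GaloisRepresentations.FramedRep.trace χ g * (Literature.NumberTheory.GaloisRepresentations.FramedRep.trace σ g ^ 2 + Literature.NumberTheory.GaloisRepresentations.FramedRep.trace σ (g * g))) ∨ (∃ σ₁ σ₂ : Literature.NumberTheory.GaloisRepresentations.FramedGaloisRep E (PadicAlgCl ℓ) 2, σ₁.toGaloisRep.IsIrreducible ∧ σ₂.toGaloisRep.IsIrreducible ∧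 Summit.Langlands.Langlands.Theorems.CoreAdequacy.LieDefect.Geometric σ₁ ∧ Summit.Langlands.Langlands.Theorems.CoreAdequacy.LieDefect.Geometric σ₂ ∧ ∀ g : Field.absoluteGaloisGroup E, Literature.NumberTheory.GaloisRepresentations.FramedRep.trace (ρ.restrictField E) g = Literature.NumberTheory.GaloisRepresentations.FramedRep.trace σ₁ g * Literature.NumberTheory.GaloisRepresentations.FramedRep.trace σ₂ g))) → (∃ τ : Field.absoluteGaloisGroup (CyclotomicField ℓ K) →* Matrix.GeneralLinearGroup (Fin n) (Literature.NumberTheory.GaloisRepresentations.padicAlgClResidueField ℓ), (ρ.restrictField (CyclotomicField ℓ K)).IsReductionOf (RingHom.id (Literature.NumberTheory.GaloisRepresentations.padicAlgClResidueField ℓ)) τ ∧ Literature.NumberTheory.GaloisRepresentations.IsAbsIrreducible τ ∧ ∃ J : Subgroup (Matrix.GeneralLinearGroup (Fin n) (Literature.NumberTheory.GaloisRepresentations.padicAlgClResidueField ℓ)), Summit.Langlands.Langlands.Theorems.CoreAdequacy.LieDefect.AboveCore τ.range J ∧ J ≤ τ.range ∧ Literature.NumberTheory.GaloisRepresentations.IsAbsIrreducible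 J.subtype ∧ (∀ f : Additive J →+ Literature.NumberTheory.GaloisRepresentations.padicAlgClResidueField ℓ, f = 0) ∧ groupCohomology.cocycles₁ (Rep.of (Literature.NumberTheory.GaloisRepresentations.Subgroup.adRep J)) ≤ groupCohomology.coboundaries₁ (Rep.of (Literature.NumberTheory.GaloisRepresentations.Subgroup.adRep J)) ∧ Literature.NumberTheory.GaloisRepresentations.Subgroup.semisimpleSpan J = ⊤) → ¬ Summit.Langlands.Langlands.Theorems.BrightMate.SolvablyReducible ρ → ¬ Summit.Langlands.Langlands.Theorems.BrightMate.SolvablyMated ι ρ → Summit.Langlands.Langlands.Theorems.CoreAdequacy.LiftTail K n hcpt ℓ ι ρ) →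
    OddSchurLayerLifting := by
  intro hT hC hX K _ _ n hcpt hn ih ℓ _ ι ρ hlt h2
  by_cases hCM : NumberField.IsCMField K
  · exact hC hT K n hcpt hn ih ℓ ι ρ hlt h2 hCM
  · exact hX K n hcpt hn ih ℓ ι ρ hlt h2 hCM

/-- O from its registered stubs (the form `ledger skeleton check` records). -/
theorem OddSchurLayerLifting_holds : OddSchurLayerLifting :=
  OddSchurLayerLifting_of stub_Tplus stub_o_cm_of_Tplus stub_o_rest

end Summit.Langlands.Langlands.Cruxes.OddSchurLayerLifting.Birth
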